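import Mathlib
import Summits.NavierStokesRegularity.NavierStokesRegularity.Theorems.EulerZoomLiouvillePowerGaugeEulerLiouvilleDSSEndpointSliceRiesz
import Summits.NavierStokesRegularity.NavierStokesRegularity.Theorems.EulerZoomLiouvillePowerGaugeEulerLiouvilleTimePeriodicTools
import Summits.NavierStokesRegularity.NavierStokesRegularity.Theorems.EulerZoomLiouvillePowerGaugeEulerLiouvilleSelfSimilarEndpointSobolevGrowth
import Literature.Analysis.FluidPDE.LocalLeraySlabGoodSlices
import HarnessLib

/-!
# Rung C2 of the crux `EulerZoomLiouville.PowerGaugeEulerLiouville` at the endpoint `ρ = 1/2`: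
# a.e. slice GRADIENT growth from the `E`-gauge; slice Riesz identification WITHOUT a growth bound

Route №10 `EulerZoomLiouville` (NavierStokesRegularity), crux E = stmt-NavierStokesRegularity-19832,
stub `stub_nonSelfSimilarRest` (DSS endpoint stratum `IsDSSPowerSpread`).  The tree's
`ae_slice_riesz_of_gauge_half` (`…DSSEndpointSliceRiesz`) uses the POINTWISE slice bound
`|u(τ, y)| ≤ C_up|y|^{1−δ}` for the cubic growth `∫_{B_L}‖u(τ)‖³ ≲ L^{5/3}`; here that growth comes from
the `E`-gauge through the weak gradient `H`:
* `EndpointSobolev.ae_slice_gradient_growth_of_gauge_half` — `a^{1/2} E(a; 0; H) ≤ c` ⇒ for a.e. `τ` in a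
  bounded window `(α, β)`, `β ≤ 0`: `∫_{B_L} |H(τ)|²_F ≤ A_τ L²` for all `L ≥ 1` (weighted dyadic series,
  as in `ae_slice_pressure_growth_of_gauge_half`);
* `EndpointSobolev.exists_setIntegral_cube_ball_le_of_sq` — `‖V‖² ∈ L¹` + weak gradient with
  `∫_{B_R}|G|²_F ≤ C_G R²` ⇒ `∫_{B_L}‖V‖³ ≤ A L^{3−4/3}` (Sobolev, `exists_sobolev_six_ball`);
* `EndpointSobolev.ae_slice_riesz_of_gauge_half_of_weakGradient` — the tree's statement with
  `(hδ1) (hδm) (hCup) (hup)` replaced by `H` and its `E`-gauge.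

WHAT THIS IS NOT: not NS, not E, not the stub — slice tools for the growth-free DSS endpoint drain.
[cite: ChaeShvydkoy2013, §3.1 proof of Thm. 3.1; Seregin2014, §6.6 p. 129]
-/


noncomputable section

-- flat `Theorems/<Route><Decl>…` files of one crux share the namespace of the crux (tree convention)
set_option linter.dupNamespace false

open MeasureTheory Set Filter Topology Metric Function TopologicalSpace
open scoped ENNReal NNReal InnerProductSpace RealInnerProductSpace Laplacian

namespace Summit.NavierStokesRegularity.NavierStokesRegularity.Theorems.PowerGaugeEulerLiouville

open Literature.Analysis Literature.Analysis.FunctionSpaces Literature.Analysis.FluidPDE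

namespace EndpointSobolev

section GradientGrowth

variable {H : ℝ → EuclideanSpace ℝ (Fin 3) → EuclideanSpace ℝ (Fin 3) →L[ℝ] EuclideanSpace ℝ (Fin 3)}

/-- **The `E`-gauge on a window × ball at the endpoint:** `a^{1/2} E(a; 0; H) ≤ c` gives
`∫∫_{(α,β) × B_a} |H|²_F ≤ c a` whenever `−a² ≤ α`, `β ≤ 0`, `a ≥ 1` (the window × ball lies in the
parabolic cylinder `Q_a(0,0)`; `TimePeriodic.setLIntegral_window_le_of_gaugeE` gives `c a^{1/2} ≤ c a`).
[folklore] -/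
theorem lintegral_window_ball_frobenius_le_of_gaugeE_half {c : ℝ≥0}
    (hE : ∀ a : ℝ, 0 < a →
      ENNReal.ofReal (a ^ (1 / 2 : ℝ)) * cknE a (0 : ℝ × EuclideanSpace ℝ (Fin 3)) H ≤ (c : ℝ≥0∞))
    {a α β : ℝ} (ha : 1 ≤ a) (hα : -(a ^ 2) ≤ α) (hβ : β ≤ 0) :
    ∫⁻ z in Ioo α β ×ˢ ball (0 : EuclideanSpace ℝ (Fin 3)) a,
        ENNReal.ofReal (frobeniusNormSq (H z.1 z.2)) ≤ ENNReal.ofReal (c * a) := by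
  have ha0 : 0 < a := one_pos.trans_le ha
  have hsub : Ioo α β ×ˢ ball (0 : EuclideanSpace ℝ (Fin 3)) a ⊆
      Ioo (-(a ^ 2)) 0 ×ˢ ball (0 : EuclideanSpace ℝ (Fin 3)) a :=
    prod_mono (Ioo_subset_Ioo hα hβ) subset_rfl
  have h := TimePeriodic.setLIntegral_window_le_of_gaugeE (ρ := 1 / 2) (T := a ^ 2) ha0 le_rfl le_rfl
    (hE a ha0)
  refine (lintegral_mono_set hsub).trans (h.trans (ENNReal.ofReal_le_ofReal ?_))
  refine mul_le_mul_of_nonneg_left ?_ c.coe_nonneg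
  calc a ^ (1 - (1 / 2 : ℝ)) ≤ a ^ (1 : ℝ) := Real.rpow_le_rpow_of_exponent_le ha (by norm_num)
    _ = a := Real.rpow_one a

/-- **Growth of a.e. slice gradient from the `E`-gauge (endpoint).**  If `H` is a.e.-strongly measurable on
the slab and `a^{1/2} E(a; 0; H) ≤ c` for all `a > 0`, then for a.e. `τ` in a bounded window `(α, β)`,
`β ≤ 0`, there is `A_τ ≥ 0` with `∫_{B_L} |H(τ)|²_F ≤ A_τ L²` for all `L ≥ 1` (the weighted dyadic series
`Σ_k 4^{−k} ∫_{B_{2^{k+k₀}}} |H(τ)|²_F` is integrable in `τ`; adapted from the tree's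
`ae_slice_pressure_growth_of_gauge_half`). [folklore] -/
theorem ae_slice_gradient_growth_of_gauge_half {c : ℝ≥0}
    (hHm : AEStronglyMeasurable (uncurry H)
      (volume.restrict (Iio (0 : ℝ) ×ˢ (univ : Set (EuclideanSpace ℝ (Fin 3))))))
    (hE : ∀ a : ℝ, 0 < a →
      ENNReal.ofReal (a ^ (1 / 2 : ℝ)) * cknE a (0 : ℝ × EuclideanSpace ℝ (Fin 3)) H ≤ (c : ℝ≥0∞))
    {α β : ℝ} (hβ : β ≤ 0) :
    ∀ᵐ τ : ℝ, τ ∈ Ioo α β → ∃ A : ℝ, 0 ≤ A ∧ ∀ L : ℝ, 1 ≤ L →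
      ∫⁻ y in ball (0 : EuclideanSpace ℝ (Fin 3)) L, ENNReal.ofReal (frobeniusNormSq (H τ y)) ≤
        ENNReal.ofReal (A * L ^ 2) := by
  obtain ⟨k₀, hk₀⟩ := pow_unbounded_of_one_lt |α| (by norm_num : (1 : ℝ) < 2)
  set I : Set ℝ := Ioo α β with hI
  have hI0 : I ⊆ Iio 0 := fun t ht => lt_of_lt_of_le ht.2 hβ
  set r : ℕ → ℝ := fun k => (2 : ℝ) ^ (k + k₀) with hr
  have hr0 : ∀ k, 0 < r k := fun k => by positivity
  have hr1 : ∀ k, (1 : ℝ) ≤ r k := fun k => one_le_pow₀ (by norm_num)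
  have hrα : ∀ k, -(r k ^ 2) ≤ α := by
    intro k
    have h1 : (2 : ℝ) ^ k₀ ≤ r k := pow_le_pow_right₀ (by norm_num) (by omega)
    have h2 : r k ≤ r k ^ 2 := by nlinarith [hr1 k]
    linarith [neg_abs_le α]
  set F : ℝ × EuclideanSpace ℝ (Fin 3) → ℝ≥0∞ := fun z => ENNReal.ofReal (frobeniusNormSq (H z.1 z.2))
    with hF
  have hJ : ∀ k, ∫⁻ z in I ×ˢ ball (0 : EuclideanSpace ℝ (Fin 3)) (r k), F z ≤ ENNReal.ofReal (c * r k) :=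
    fun k => lintegral_window_ball_frobenius_le_of_gaugeE_half hE (hr1 k) (hrα k) hβ
  have hprodI : (volume.restrict I).prod (volume : Measure (EuclideanSpace ℝ (Fin 3))) =
      volume.restrict (I ×ˢ (univ : Set (EuclideanSpace ℝ (Fin 3)))) := by
    rw [Measure.restrict_prod_eq_prod_univ, ← Measure.volume_eq_prod]
  have hHmI : AEStronglyMeasurable (uncurry H)
      ((volume.restrict I).prod (volume : Measure (EuclideanSpace ℝ (Fin 3)))) := by
    rw [hprodI]; exact hHm.mono_measure (Measure.restrict_mono (prod_mono hI0 subset_rfl) le_rfl)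
  have hFm : AEMeasurable F ((volume.restrict I).prod volume) :=
    (continuous_frobeniusNormSq'.comp_aestronglyMeasurable hHmI).aemeasurable.ennreal_ofReal
  set f : ℕ → ℝ × EuclideanSpace ℝ (Fin 3) → ℝ≥0∞ := fun k z =>
    ((univ : Set ℝ) ×ˢ ball (0 : EuclideanSpace ℝ (Fin 3)) (r k)).indicator F z with hf
  have hfm : ∀ k, AEMeasurable (f k) ((volume.restrict I).prod volume) := fun k =>
    hFm.indicator (MeasurableSet.univ.prod measurableSet_ball)
  have hg : ∀ k τ, (∫⁻ y, f k (τ, y)) =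
      ∫⁻ y in ball (0 : EuclideanSpace ℝ (Fin 3)) (r k), F (τ, y) := by
    intro k τ
    rw [← lintegral_indicator measurableSet_ball]
    congr 1; funext y
    by_cases hy : y ∈ ball (0 : EuclideanSpace ℝ (Fin 3)) (r k)
    · rw [indicator_of_mem hy]
      exact indicator_of_mem (show (τ, y) ∈ (univ : Set ℝ) ×ˢ ball (0 : EuclideanSpace ℝ (Fin 3)) (r k)
        from ⟨mem_univ _, hy⟩) _
    · rw [indicator_of_notMem hy]
      exact indicator_of_notMem (fun h => hy h.2) _
  have hgm : ∀ k, AEMeasurable (fun τ => ∫⁻ y in ball (0 : EuclideanSpace ℝ (Fin 3)) (r k),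
      F (τ, y)) (volume.restrict I) := by
    intro k
    have h := (hfm k).lintegral_prod_right'
    simp_rw [hg] at h
    exact h
  have hTon : ∀ k, ∫⁻ τ in I, ∫⁻ y in ball (0 : EuclideanSpace ℝ (Fin 3)) (r k), F (τ, y) =
      ∫⁻ z in I ×ˢ ball (0 : EuclideanSpace ℝ (Fin 3)) (r k), F z := by
    intro k
    have h1 : ∫⁻ z, f k z ∂((volume.restrict I).prod volume) = ∫⁻ τ in I, ∫⁻ y, f k (τ, y) :=
      lintegral_prod _ (hfm k)
    simp_rw [hg] at h1
    rw [← h1, hprodI, lintegral_indicator (MeasurableSet.univ.prod measurableSet_ball),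
      Measure.restrict_restrict (MeasurableSet.univ.prod measurableSet_ball), prod_inter_prod,
      univ_inter, inter_univ]
  set w : ℕ → ℝ≥0∞ := fun k => ENNReal.ofReal ((1 / 4 : ℝ) ^ k) with hw
  set G : ℝ → ℝ≥0∞ := fun τ => ∑' k, w k *
    ∫⁻ y in ball (0 : EuclideanSpace ℝ (Fin 3)) (r k), F (τ, y) with hG
  have hGm : AEMeasurable G (volume.restrict I) :=
    AEMeasurable.tsum fun k => (hgm k).const_mul _
  have hGint : ∫⁻ τ in I, G τ ≠ ⊤ := by
    have h1 : ∫⁻ τ in I, G τ = ∑' k, w k *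
        ∫⁻ z in I ×ˢ ball (0 : EuclideanSpace ℝ (Fin 3)) (r k), F z := by
      rw [hG, lintegral_tsum fun k => (hgm k).const_mul _]
      congr 1; funext k
      rw [lintegral_const_mul'' _ (hgm k), hTon k]
    rw [h1]
    have h2 : ∀ k, w k * ∫⁻ z in I ×ˢ ball (0 : EuclideanSpace ℝ (Fin 3)) (r k), F z ≤
        ENNReal.ofReal (c * 2 ^ k₀ * (1 / 2 : ℝ) ^ k) := by
      intro k
      calc w k * ∫⁻ z in I ×ˢ ball (0 : EuclideanSpace ℝ (Fin 3)) (r k), F z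
          ≤ w k * ENNReal.ofReal (c * r k) := mul_le_mul_right (hJ k) _
        _ = ENNReal.ofReal ((1 / 4 : ℝ) ^ k * (c * r k)) := by rw [hw, ← ENNReal.ofReal_mul (by positivity)]
        _ = ENNReal.ofReal (c * 2 ^ k₀ * (1 / 2 : ℝ) ^ k) := by
            congr 1
            have e : (1 / 4 : ℝ) ^ k * 2 ^ k = (1 / 2 : ℝ) ^ k := by rw [← mul_pow]; norm_num
            calc (1 / 4 : ℝ) ^ k * (c * r k) = c * 2 ^ k₀ * ((1 / 4 : ℝ) ^ k * 2 ^ k) := by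
                  rw [hr]; ring
              _ = _ := by rw [e]
    refine ne_of_lt (lt_of_le_of_lt (ENNReal.tsum_le_tsum h2) ?_)
    rw [← ENNReal.ofReal_tsum_of_nonneg (fun k => by positivity)
      ((summable_geometric_of_lt_one (by norm_num) (by norm_num)).mul_left _)]
    exact ENNReal.ofReal_lt_top
  have hae := ae_lt_top' hGm hGint
  rw [ae_restrict_iff' measurableSet_Ioo] at hae
  filter_upwards [hae] with τ hτ hτI
  have hGτ := hτ hτI
  refine ⟨4 * (G τ).toReal, by positivity, fun L hL => ?_⟩
  have hL0 : 0 < L := by linarith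
  obtain ⟨n, hn1, hn2⟩ := exists_nat_pow_near hL (by norm_num : (1 : ℝ) < 2)
  have hLr : L ≤ r (n + 1) :=
    hn2.le.trans (pow_le_pow_right₀ (by norm_num) (by omega))
  have hk : w (n + 1) * ∫⁻ y in ball (0 : EuclideanSpace ℝ (Fin 3)) (r (n + 1)), F (τ, y) ≤
      G τ := ENNReal.le_tsum (n + 1)
  have hw0 : w (n + 1) ≠ 0 := (ENNReal.ofReal_pos.2 (by positivity)).ne'
  have hwinv : (w (n + 1))⁻¹ = ENNReal.ofReal ((4 : ℝ) ^ (n + 1)) := by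
    rw [hw]
    show (ENNReal.ofReal ((1 / 4 : ℝ) ^ (n + 1)))⁻¹ = ENNReal.ofReal ((4 : ℝ) ^ (n + 1))
    rw [← ENNReal.ofReal_inv_of_pos (by positivity), ← inv_pow, one_div, inv_inv]
  have h4L : (4 : ℝ) ^ (n + 1) ≤ 4 * L ^ 2 := by
    have e : (4 : ℝ) ^ n = (2 ^ n) ^ 2 := by
      rw [← pow_mul, show (4 : ℝ) = 2 ^ 2 by norm_num, ← pow_mul, mul_comm]
    rw [pow_succ, e]
    have : (0 : ℝ) ≤ 2 ^ n := by positivity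
    nlinarith
  calc ∫⁻ y in ball (0 : EuclideanSpace ℝ (Fin 3)) L, ENNReal.ofReal (frobeniusNormSq (H τ y))
      ≤ ∫⁻ y in ball (0 : EuclideanSpace ℝ (Fin 3)) (r (n + 1)), F (τ, y) :=
        lintegral_mono_set (ball_subset_ball hLr)
    _ = (w (n + 1))⁻¹ * (w (n + 1) *
          ∫⁻ y in ball (0 : EuclideanSpace ℝ (Fin 3)) (r (n + 1)), F (τ, y)) := by
        rw [← mul_assoc, ENNReal.inv_mul_cancel hw0 ENNReal.ofReal_ne_top, one_mul]
    _ ≤ (w (n + 1))⁻¹ * G τ := mul_le_mul_right hk _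
    _ ≤ ENNReal.ofReal (4 * L ^ 2) * G τ := by
        rw [hwinv]; exact mul_le_mul_left (ENNReal.ofReal_le_ofReal h4L) _
    _ = ENNReal.ofReal (4 * (G τ).toReal * L ^ 2) := by
        rw [show 4 * (G τ).toReal * L ^ 2 = (4 * L ^ 2) * (G τ).toReal by ring,
          ENNReal.ofReal_mul (by positivity : (0 : ℝ) ≤ 4 * L ^ 2), ENNReal.ofReal_toReal hGτ.ne]

end GradientGrowth

section CubeGrowth

variable {V : EuclideanSpace ℝ (Fin 3) → EuclideanSpace ℝ (Fin 3)}

/-- **Cubic growth on balls from a weak gradient with quadratic growth** (`σ = 4/3` input of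
`pressure_ae_eq_scaleQ_of_poisson`): `V ∈ L²`, a weak gradient `G` with `∫_{B_R}|G|²_F ≤ C_G R²`
(`R ≥ 1`) ⇒ `∫_{B_L} ‖V‖³ ≤ A L^{3−4/3}` for `L ≥ 1` (Sobolev: `∫_{B_L}‖V‖⁶ ≤ (C(√(∫‖V‖²) + √C_G) L)⁶`,
two Cauchy–Schwarz steps: `∫_{B_L}‖V‖³ ≤ (∫_{B_L}‖V‖⁶)^{1/4} (∫‖V‖²)^{3/4} ≲ L^{3/2} ≤ L^{5/3}`). [folklore] -/
theorem exists_setIntegral_cube_ball_le_of_sq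
    {G : EuclideanSpace ℝ (Fin 3) → EuclideanSpace ℝ (Fin 3) →L[ℝ] EuclideanSpace ℝ (Fin 3)}
    (hW : HasWeakFDerivOn (⊤ : Opens (EuclideanSpace ℝ (Fin 3))) volume V G)
    (hVm : AEStronglyMeasurable V volume) (hGm : AEStronglyMeasurable G volume)
    (hV2 : Integrable (fun z => ‖V z‖ ^ 2) volume) {C_G : ℝ} (hCG : 0 ≤ C_G)
    (hGB : ∀ R : ℝ, 1 ≤ R →
      (∫⁻ y in ball (0 : EuclideanSpace ℝ (Fin 3)) R, ENNReal.ofReal (frobeniusNormSq (G y))) ≤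
        ENNReal.ofReal (C_G * R ^ 2)) :
    ∃ A : ℝ, 0 ≤ A ∧ ∀ L : ℝ, 1 ≤ L →
      ∫ y in ball (0 : EuclideanSpace ℝ (Fin 3)) L, ‖V y‖ ^ 3 ≤ A * L ^ (3 - (4 / 3 : ℝ)) := by
  obtain ⟨C₆, hC₆0, hSob⟩ := exists_sobolev_six_ball
  set E₂ : ℝ := ∫ z, ‖V z‖ ^ 2 with hE₂
  have hE₂0 : 0 ≤ E₂ := integral_nonneg fun z => by positivity
  set N : ℝ := C₆ * (Real.sqrt E₂ + Real.sqrt C_G) with hN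
  have hN0 : 0 ≤ N := by positivity
  refine ⟨(N ^ 6) ^ (1 / 4 : ℝ) * E₂ ^ (3 / 4 : ℝ), by positivity, fun L hL => ?_⟩
  have hL0 : 0 < L := one_pos.trans_le hL
  have hM0 : 0 ≤ C_G * L ^ 2 := by positivity
  obtain ⟨hI6, hq⟩ := hSob V G hW hVm hGm hV2 L _ hL0 hM0 (hGB L hL)
  have hb1 : L⁻¹ * Real.sqrt E₂ ≤ Real.sqrt E₂ * L := by
    have h1 : L⁻¹ ≤ 1 := inv_le_one_of_one_le₀ hL
    calc L⁻¹ * Real.sqrt E₂ ≤ 1 * Real.sqrt E₂ := mul_le_mul_of_nonneg_right h1 (Real.sqrt_nonneg _)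
      _ = Real.sqrt E₂ * 1 := by ring
      _ ≤ Real.sqrt E₂ * L := mul_le_mul_of_nonneg_left hL (Real.sqrt_nonneg _)
  have hb2 : Real.sqrt (C_G * L ^ 2) = Real.sqrt C_G * L := by
    rw [Real.sqrt_mul hCG, Real.sqrt_sq hL0.le]
  have hbase : C₆ * (L⁻¹ * Real.sqrt E₂ + Real.sqrt (C_G * L ^ 2)) ≤ N * L := by
    rw [hb2, hN]
    have : L⁻¹ * Real.sqrt E₂ + Real.sqrt C_G * L ≤ (Real.sqrt E₂ + Real.sqrt C_G) * L := by
      rw [add_mul]; exact add_le_add hb1 le_rfl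
    calc C₆ * (L⁻¹ * Real.sqrt E₂ + Real.sqrt C_G * L)
        ≤ C₆ * ((Real.sqrt E₂ + Real.sqrt C_G) * L) := mul_le_mul_of_nonneg_left this hC₆0
      _ = C₆ * (Real.sqrt E₂ + Real.sqrt C_G) * L := by ring
  have hbase0 : 0 ≤ C₆ * (L⁻¹ * Real.sqrt E₂ + Real.sqrt (C_G * L ^ 2)) := by positivity
  have hq' : ∫ y in ball (0 : EuclideanSpace ℝ (Fin 3)) L, ‖V y‖ ^ 6 ≤ N ^ 6 * L ^ 6 := by
    refine hq.trans ?_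
    rw [← mul_pow]; exact pow_le_pow_left₀ hbase0 hbase 6
  have hq0 : 0 ≤ ∫ y in ball (0 : EuclideanSpace ℝ (Fin 3)) L, ‖V y‖ ^ 6 :=
    setIntegral_nonneg measurableSet_ball fun y _ => by positivity
  have he : ∫ y in ball (0 : EuclideanSpace ℝ (Fin 3)) L, ‖V y‖ ^ 2 ≤ E₂ :=
    setIntegral_le_integral hV2 (Eventually.of_forall fun y => by positivity)
  have he0 : 0 ≤ ∫ y in ball (0 : EuclideanSpace ℝ (Fin 3)) L, ‖V y‖ ^ 2 :=
    setIntegral_nonneg measurableSet_ball fun y _ => by positivity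
  have h3 := setIntegral_norm_pow_three_le hVm hV2.integrableOn hI6
  have hpow : (N ^ 6 * L ^ 6) ^ (1 / 4 : ℝ) = (N ^ 6) ^ (1 / 4 : ℝ) * L ^ (3 / 2 : ℝ) := by
    rw [Real.mul_rpow (by positivity) (by positivity), ← Real.rpow_natCast L 6,
      ← Real.rpow_mul hL0.le]
    norm_num
  have hL32 : L ^ (3 / 2 : ℝ) ≤ L ^ (3 - (4 / 3 : ℝ)) :=
    Real.rpow_le_rpow_of_exponent_le hL (by norm_num)
  calc ∫ y in ball (0 : EuclideanSpace ℝ (Fin 3)) L, ‖V y‖ ^ 3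
      ≤ (∫ y in ball (0 : EuclideanSpace ℝ (Fin 3)) L, ‖V y‖ ^ 6) ^ (1 / 4 : ℝ) *
          (∫ y in ball (0 : EuclideanSpace ℝ (Fin 3)) L, ‖V y‖ ^ 2) ^ (3 / 4 : ℝ) := h3
    _ ≤ (N ^ 6 * L ^ 6) ^ (1 / 4 : ℝ) * E₂ ^ (3 / 4 : ℝ) := by
        gcongr
    _ = (N ^ 6) ^ (1 / 4 : ℝ) * E₂ ^ (3 / 4 : ℝ) * L ^ (3 / 2 : ℝ) := by rw [hpow]; ring
    _ ≤ (N ^ 6) ^ (1 / 4 : ℝ) * E₂ ^ (3 / 4 : ℝ) * L ^ (3 - (4 / 3 : ℝ)) :=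
        mul_le_mul_of_nonneg_left hL32 (by positivity)

end CubeGrowth

section SliceRiesz

variable {u : ℝ → EuclideanSpace ℝ (Fin 3) → EuclideanSpace ℝ (Fin 3)}
  {p : ℝ → EuclideanSpace ℝ (Fin 3) → ℝ}
  {H : ℝ → EuclideanSpace ℝ (Fin 3) → EuclideanSpace ℝ (Fin 3) →L[ℝ] EuclideanSpace ℝ (Fin 3)}

/-- **A.e. slice pressure is the scale-wise Riesz pressure of the slice (endpoint, class) — no growth
hypothesis.**  Let `(u, p)` be a suitable weak Euler/NS pair on the slab with a weak spatial gradient `H`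
and the `A`-, `E`- and `D`-gauges at `ρ = 1/2`.  Then for a.e. `τ` in a window `(α, β)`, `β < 0`, and
every `R ≥ 1`, a.e. on `B_{R/2}`: `p(τ) = Π[u(τ)·1_{B_R}] + ∫_{|z| ≥ R} K(·−z)(u(τ, z)) dz`.  (Slice
Poisson identity, `D`-gauge growth `∫_{B_L}|p(τ)| ≲ L^{7/3}`, cubic growth `≲ L^{5/3}` from the slice weak
gradient `H(τ)` and its `E`-gauge growth, and `pressure_ae_eq_scaleQ_of_poisson` with `σ = 2/3`; the body is
the tree's `ae_slice_riesz_of_gauge_half` but for the velocity growth.) [cite: Seregin2014, §6.6 p. 129] -/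
theorem ae_slice_riesz_of_gauge_half_of_weakGradient {ν : ℝ} {c : ℝ≥0}
    (hsw : IsSuitableWeakSolutionOn (slab (EuclideanSpace ℝ (Fin 3)) (Iio 0) isOpen_Iio) ν 0 u p)
    (hH : HasWeakSpatialGradientOn (slab (EuclideanSpace ℝ (Fin 3)) (Iio 0) isOpen_Iio) u H)
    (hA : ∀ a : ℝ, 0 < a →
      ENNReal.ofReal (a ^ (2 * (1 / 2 : ℝ))) * cknA a (0 : ℝ × EuclideanSpace ℝ (Fin 3)) u ≤ (c : ℝ≥0∞))
    (hE : ∀ a : ℝ, 0 < a →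
      ENNReal.ofReal (a ^ (1 / 2 : ℝ)) * cknE a (0 : ℝ × EuclideanSpace ℝ (Fin 3)) H ≤ (c : ℝ≥0∞))
    (hD : ∀ a : ℝ, 0 < a →
      ENNReal.ofReal (a ^ (2 * (1 / 2 : ℝ))) * cknD a (0 : ℝ × EuclideanSpace ℝ (Fin 3)) p ≤ (c : ℝ≥0∞))
    {α β : ℝ} (hβ : β < 0) :
    ∀ᵐ τ : ℝ, τ ∈ Ioo α β → ∀ R : ℝ, 1 ≤ R → ∀ᵐ y ∂volume, ‖y‖ < R / 2 →
      p τ y = rieszPressure ((ball (0 : EuclideanSpace ℝ (Fin 3)) R).indicator (u τ)) y +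
        ∫ z in {z | R ≤ ‖z‖}, pressureKernel (y - z) (u τ z) := by
  have hum : AEStronglyMeasurable (uncurry u)
      (volume.restrict (Iio (0 : ℝ) ×ˢ (univ : Set (EuclideanSpace ℝ (Fin 3))))) := by
    obtain ⟨G, hG, -, -⟩ := hsw.localEnergy
    simpa [slab] using hG.locallyIntegrableOn.aestronglyMeasurable
  have hpm : AEStronglyMeasurable (uncurry p)
      (volume.restrict (Iio (0 : ℝ) ×ˢ (univ : Set (EuclideanSpace ℝ (Fin 3))))) := by
    simpa [slab] using hsw.distributional.2.2.1.aestronglyMeasurable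
  have hHm : AEStronglyMeasurable (uncurry H)
      (volume.restrict (Iio (0 : ℝ) ×ˢ (univ : Set (EuclideanSpace ℝ (Fin 3))))) := by
    simpa [slab] using hH.locallyIntegrableOn_grad.aestronglyMeasurable
  have h1 := ae_slice_aestronglyMeasurable hum
  have h2 := ae_slice_energy_of_gauge_half hum hA
  have h3 := ae_slice_cube_locallyIntegrable hsw
  have h4 := ae_slice_pressure_locallyIntegrable hsw
  have h5 := ae_slice_pressure_growth_of_gauge_half hpm hD hβ.le (α := α)
  have h7 := ae_slice_gradient_growth_of_gauge_half hHm hE hβ.le (α := α)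
  -- a.e. slice of `H` is a weak derivative of the slice of `u`, and is measurable
  have h8 : ∀ᵐ τ : ℝ, τ ∈ Ioo α β →
      HasWeakFDerivOn (⊤ : Opens (EuclideanSpace ℝ (Fin 3))) volume (u τ) (H τ) := by
    have hW := (hH.mono (slab_mono (Ioo_subset_Iio_self.trans (Iio_subset_Iio hβ.le)) :
      slab (EuclideanSpace ℝ (Fin 3)) (Ioo α β) isOpen_Ioo ≤
        slab (EuclideanSpace ℝ (Fin 3)) (Iio 0) isOpen_Iio)).ae_hasWeakFDerivOn_slice_slab
    exact (ae_restrict_iff' measurableSet_Ioo).1 hW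
  have h9 : ∀ᵐ τ : ℝ, τ ∈ Ioo α β → AEStronglyMeasurable (H τ) volume := by
    have hHm' : AEStronglyMeasurable (uncurry H)
        (((volume : Measure ℝ).restrict (Iio (0 : ℝ))).prod (volume : Measure (EuclideanSpace ℝ (Fin 3)))) := by
      rw [Measure.restrict_prod_eq_prod_univ, ← Measure.volume_eq_prod]; exact hHm
    have h := (ae_restrict_iff' measurableSet_Iio).1 hHm'.prodMk_left
    filter_upwards [h] with τ hτ hτI
    exact hτ (hτI.2.trans hβ)
  -- the slice pressure Poisson identity on `(α, β) × ℝ³`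
  set Q : Opens (ℝ × EuclideanSpace ℝ (Fin 3)) :=
    ⟨Ioo α β ×ˢ ((⊤ : Opens (EuclideanSpace ℝ (Fin 3))) : Set (EuclideanSpace ℝ (Fin 3))),
      isOpen_Ioo.prod (⊤ : Opens (EuclideanSpace ℝ (Fin 3))).isOpen⟩ with hQ
  have hQle : Q ≤ slab (EuclideanSpace ℝ (Fin 3)) (Iio 0) isOpen_Iio := by
    intro z hz
    have hz' : z ∈ Ioo α β ×ˢ ((⊤ : Opens (EuclideanSpace ℝ (Fin 3))) :
        Set (EuclideanSpace ℝ (Fin 3))) := hz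
    exact mem_slab.2 (lt_trans (mem_prod.1 hz').1.2 hβ)
  have hns : IsDistributionalNSSolutionOn Q ν 0 u p := hsw.distributional.of_le hQle
  have h6 := IsDistributionalNSSolutionOn.ae_forall_slice_pressure_identity
    (a := α) (b := β) (Ω := (⊤ : Opens (EuclideanSpace ℝ (Fin 3)))) hns
    (by
      have e : (uncurry (0 : ℝ → EuclideanSpace ℝ (Fin 3) → EuclideanSpace ℝ (Fin 3))) =
          fun _ => 0 := by funext z; rfl
      rw [e]; exact locallyIntegrableOn_zero) (fun φ _ => by simp)
  rw [ae_restrict_iff' measurableSet_Ioo] at h6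
  filter_upwards [h1, h2, h3, h4, h5, h6, h7, h8, h9] with τ h1τ h2τ h3τ h4τ h5τ h6τ h7τ h8τ h9τ hτI
  have hτ0 : τ < 0 := hτI.2.trans hβ
  have hm := h1τ hτ0
  obtain ⟨hi2, -⟩ := h2τ hτ0
  have hc3 := h3τ hτ0
  have hp1 := h4τ hτ0
  obtain ⟨A, hA0, hAg⟩ := h5τ hτI
  obtain ⟨A', hA'0, hA'g⟩ := h7τ hτI
  have hpmτ : AEStronglyMeasurable (p τ) volume := hp1.aestronglyMeasurable
  have hPoisson : ∀ θ : EuclideanSpace ℝ (Fin 3) → ℝ, ContDiff ℝ (⊤ : ℕ∞) θ → HasCompactSupport θ →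
      ∫ y, p τ y * (Δ θ) y = -∫ y, fderiv ℝ (fderiv ℝ θ) y (u τ y) (u τ y) := by
    intro θ hθ hθc
    refine h6τ hτI ?_ ?_ ?_ θ ⟨hθ, hθc, by simp⟩
    · rw [Opens.coe_top, Measure.restrict_univ]; exact hm
    · rw [Opens.coe_top, locallyIntegrableOn_univ]; exact hi2.locallyIntegrable
    · rw [Opens.coe_top, locallyIntegrableOn_univ]; exact hp1
  set v₁ : ℝ := volume.real (ball (0 : EuclideanSpace ℝ (Fin 3)) 1) with hv₁
  have hv₁0 : 0 ≤ v₁ := measureReal_nonneg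
  set AP : ℝ := A ^ (2 / 3 : ℝ) * v₁ ^ (1 / 3 : ℝ) with hAP
  have hAP0 : 0 ≤ AP := by positivity
  obtain ⟨AV, hAV0, hVg0⟩ := exists_setIntegral_cube_ball_le_of_sq (h8τ hτI) hm (h9τ hτI) hi2 hA'0 hA'g
  have hPg : ∀ L : ℝ, 1 ≤ L → ∫ y in ball (0 : EuclideanSpace ℝ (Fin 3)) L, |p τ y| ≤
      max AP AV * L ^ (3 - (2 / 3 : ℝ)) := by
    intro L hL
    have hL0 : 0 < L := by linarith
    have h := setIntegral_abs_le_of_lintegral_ball hpmτ (M := A * L ^ 2) (by positivity) hL0 (hAg L hL)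
    have e1 : (A * L ^ 2) ^ (2 / 3 : ℝ) = A ^ (2 / 3 : ℝ) * L ^ (4 / 3 : ℝ) := by
      rw [Real.mul_rpow hA0 (by positivity), ← Real.rpow_natCast L 2, ← Real.rpow_mul hL0.le]
      norm_num
    have e2 : (L ^ 3 * v₁) ^ (1 / 3 : ℝ) = L * v₁ ^ (1 / 3 : ℝ) := by
      rw [Real.mul_rpow (by positivity) hv₁0, ← Real.rpow_natCast L 3, ← Real.rpow_mul hL0.le]
      norm_num
    have e3 : L ^ (4 / 3 : ℝ) * L = L ^ (3 - (2 / 3 : ℝ)) := by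
      rw [← Real.rpow_add_one hL0.ne']; norm_num
    calc ∫ y in ball (0 : EuclideanSpace ℝ (Fin 3)) L, |p τ y|
        ≤ (A * L ^ 2) ^ (2 / 3 : ℝ) * (L ^ 3 * v₁) ^ (1 / 3 : ℝ) := h
      _ = AP * L ^ (3 - (2 / 3 : ℝ)) := by rw [e1, e2, ← e3, hAP]; ring
      _ ≤ max AP AV * L ^ (3 - (2 / 3 : ℝ)) :=
          mul_le_mul_of_nonneg_right (le_max_left _ _) (by positivity)
  have hVg : ∀ L : ℝ, 1 ≤ L → ∫ y in ball (0 : EuclideanSpace ℝ (Fin 3)) L, ‖u τ y‖ ^ 3 ≤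
      max AP AV * L ^ (3 - (2 / 3 : ℝ)) := by
    intro L hL
    calc ∫ y in ball (0 : EuclideanSpace ℝ (Fin 3)) L, ‖u τ y‖ ^ 3 ≤ AV * L ^ (3 - (4 / 3 : ℝ)) :=
          hVg0 L hL
      _ ≤ AV * L ^ (3 - (2 / 3 : ℝ)) :=
          mul_le_mul_of_nonneg_left (Real.rpow_le_rpow_of_exponent_le hL (by norm_num)) hAV0
      _ ≤ max AP AV * L ^ (3 - (2 / 3 : ℝ)) :=
          mul_le_mul_of_nonneg_right (le_max_right _ _) (by positivity)
  intro R hR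
  exact pressure_ae_eq_scaleQ_of_poisson hm hi2 hc3 hp1 hPoisson (σ := 2 / 3) (by norm_num) (by norm_num)
    (le_max_of_le_left hAP0) hPg hVg (by linarith)

end SliceRiesz

end EndpointSobolev

end Summit.NavierStokesRegularity.NavierStokesRegularity.Theorems.PowerGaugeEulerLiouville
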